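import Summits.HodgeConjecture.CorCM.MumfordTateRankFiveCenter
import Summits.HodgeConjecture.CorCM.MumfordTateRankFourFactorDimension
import Summits.HodgeConjecture.CorCM.EndAlgebraCenterAlgebra
import HarnessLib

/-!
# The rung `dim Hg(H¹(X)) = 4` of the Mumford–Tate rank ladder for complex abelian varieties NOT of CM type, II:
# `X ∼ B^{m} × E^{m'}` with `E` a CM elliptic curve and `B` simple, not of CM type, `dim End⁰(B) = (dim B)²`

COR-CM (cell `pub-hodgecm2`, seat `b27` gen 33, count-neutral lane MT-RANK-FIVE; theorems only, no definition, no
named fact; UNCONDITIONAL — nothing here uses or asserts HC_CM).  Sequel of `CorCM/MumfordTateRankFiveCenter`.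

* **`exists_isIsogenous_two_powers_of_finrank_hodgeLie_eq_four`** — for a complex abelian variety `X` NOT of CM type
  with `dim_ℚ Lie Hg(H¹(X)) = 4`: the isotypic decomposition of `X` has EXACTLY TWO components,
  `X ∼ Bᵢ^{nᵢ+1} × Bⱼ^{nⱼ+1}`, where `Bⱼ` is an elliptic curve with `dim_ℚ End⁰(Bⱼ) = 2` (complex multiplication;
  `IsOfCMType Bⱼ`) and `Bᵢ` is simple, NOT of CM type, with `dim_ℚ End⁰(Bᵢ) = (dim Bᵢ)²` and `dim Bᵢ ≤ 2` (the abelian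
  varieties with `Hg = SL₂`: a non-CM elliptic curve or an abelian surface with quaternion multiplication,
  `CorCM/MumfordTateRankFourFactorDimension`).
  Proof (algebra only): read `z ∈ Z(End⁰ X)`, `z³ = qz` of the previous file in `End⁰(X) ≅ ∏ₗ End⁰(Bₗ^{nₗ+1})`:
  each `ζₗ` lies in the field `Z(End⁰(Bₗ^{nₗ+1}))` (`ζₗ = 0` or `ζₗ² = q`; both occur), the corner `{w | zw = 0}` has
  centre `ℚ` (exactly one `ζᵢ = 0`), and the dimension identities `x² = 4(nᵢ+1)²dᵢ`, `y² = 2Σ_{l≠i}(nₗ+1)²dₗ`,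
  `x + y = 2Σₗ(nₗ+1)dim Bₗ`, `dₗ ≤ 2 dim Bₗ` force `dᵢ = (dim Bᵢ)²` and a single `j ≠ i`, `dim Bⱼ = 1`, `dⱼ = 2`.
* `exists_isIsogenous_powers_of_mtRank_le_five` — for `X` NOT of CM type with `0 < dim X` and `dim MT(H¹X) ≤ 5`:
  either `dim Lie Hg ≤ 3` and `X ∼ B^{m+1}` (the rung of `CorCM/MumfordTateRankFour`, restated under the Hodge-group
  hypothesis in `CorCM/MumfordTateRankFiveCenter`) or `dim Lie Hg = 4` and the above shape.

## References

* [MoonenZarhin1999LowDim] B. Moonen, Yu. Zarhin, *Hodge classes on abelian varieties of low dimension*, Math. Ann.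
  315 (1999), §2 ((2.1)–(2.5): `MT = 𝔾ₘ·Hg`, `End⁰(X) = End_{Hg}(H¹)`, products).
* [MumfordAV1970] D. Mumford, *Abelian Varieties* (1970), §19 Thm. 1 Cor. 1–2 and p. 174 (`End⁰(∏ Aᵢ^{nᵢ})`).
* [Deligne1982HodgeCycles] P. Deligne, *Hodge cycles on abelian varieties*, LNM 900 (1982), I §3, Ex. 3.7.
-/

noncomputable section

open scoped TensorProduct
open CategoryTheory CategoryTheory.Limits Module

namespace Summit.HodgeConjecture.CorCM

open Literature.AlgebraicGeometry.Motives
open Literature.AlgebraicGeometry.Motives.AbelianVariety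
open Literature.AlgebraicGeometry.Motives.HodgeStructure
open Literature.AlgebraicGeometry.HodgeTheory
open Literature.AlgebraicGeometry.ComplexMultiplication (nontrivial_endAlgebra_of_dim_pos)
open Literature.AlgebraicGeometry.Milne1999 (IsOfCMType isOfCMType_iff_of_isIsogenous)
open Summit.HodgeConjecture.CorCM.CMProductEnd (nonempty_algEquiv_center_endAlgebra_biproduct
  isField_center_endAlgebra_of_isSimple orthogonal_biproduct_powers)

/-! ## The isotypic decomposition of a non-CM abelian variety with `dim Hg(H¹X) = 4` -/

variable [HodgeTensorFacts.{0, 0}] {X : AbelianVariety ℂ} {n : ℕ}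

/-- **Structure of complex abelian varieties NOT of CM type with `dim Hg(H¹(X)) = 4`.**  Along the isotypic
decomposition `X ∼ ⨁ₗ Bₗ^{nₗ+1}` (`Bₗ` simple of positive dimension, pairwise non-isogenous) there are EXACTLY two
indices `i ≠ j` (every index is `i` or `j`), with: `Bᵢ` NOT of CM type, `dim_ℚ End⁰(Bᵢ) = (dim Bᵢ)²`, `dim Bᵢ ≤ 2`;
`Bⱼ` an elliptic curve (`dim Bⱼ = 1`) with `dim_ℚ End⁰(Bⱼ) = 2`, of CM type.  So `X ∼ B^{m} × E^{m'}` with `E` a CM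
elliptic curve and `B` a non-CM elliptic curve or an abelian surface with `dim End⁰ = 4` (Moonen–Zarhin §2: the abelian
varieties with `Hg = SL₂ × U(1)` up to isogeny of `Hg`).  Proof: the algebra of `CorCM/MumfordTateRankFiveCenter` read in
`End⁰(X) ≅ ∏ₗ End⁰(Bₗ^{nₗ+1})`. [cite: MoonenZarhin1999LowDim, §2] [cite: MumfordAV1970, §19 Thm. 1 Cor. 1–2 and p. 174] -/
theorem exists_isIsogenous_two_powers_of_finrank_hodgeLie_eq_four (hX : IsSmoothProjective n X.X) (hcm : ¬ IsOfCMType X)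
    (h4 : haveI := BettiUniverse.finite hX 1
      Module.finrank ℚ (BettiUniverse.hodge exists_isReal_hodgeModel_holds hX 1).hodgeLie = 4) :
    ∃ (r : ℕ) (B : Fin r → AbelianVariety ℂ) (nB : Fin r → ℕ) (i j : Fin r),
      (∀ l, (B l).IsSimple) ∧ (∀ l, 0 < (B l).dim) ∧ (∀ l l', l ≠ l' → ¬ IsIsogenous (B l) (B l')) ∧
      IsIsogenous X (⨁ fun l => ⨁ fun _ : Fin (nB l + 1) => B l) ∧
      i ≠ j ∧ (∀ l, l = i ∨ l = j) ∧
      ¬ IsOfCMType (B i) ∧ Module.finrank ℚ (B i).endAlgebra = (B i).dim ^ 2 ∧ (B i).dim ≤ 2 ∧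
      (B j).dim = 1 ∧ Module.finrank ℚ (B j).endAlgebra = 2 ∧ IsOfCMType (B j) := by
  classical
  obtain ⟨z, q, hzc, hq, hz0, hz3, hzu, hcen, x, y, hxy, hx0, hy0, hxK, hyK⟩ :=
    exists_center_cube_of_finrank_hodgeLie_eq_four hX hcm h4
  obtain ⟨r, B, nB, hS, hd, hni, hXB⟩ := exists_isIsogenous_biproduct_powers_fin X
  have horth := orthogonal_of_isSimple_of_not_isIsogenous hS hni
  have horth' := orthogonal_biproduct_powers (n := nB) horth
  -- `End⁰(X) ≅ ∏ₗ R l`, `R l = End⁰(B l ^ (nB l + 1))`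
  set A : Fin r → AbelianVariety ℂ := fun l => ⨁ fun _ : Fin (nB l + 1) => B l with hAdef
  obtain ⟨e₁⟩ := hXB.nonempty_endAlgebra_algEquiv
  obtain ⟨e₂, -⟩ := nonempty_algEquiv_endAlgebra_biproduct_pi (A := A) horth'
  let e : X.endAlgebra ≃ₐ[ℚ] (∀ l, (A l).endAlgebra) := e₁.trans e₂
  haveI : ∀ l, Module.Finite ℚ (A l).endAlgebra := fun l => finiteDimensional_endAlgebra_holds (A l)
  haveI : Module.Finite ℚ X.endAlgebra := finiteDimensional_endAlgebra_holds X
  set ζ : ∀ l, (A l).endAlgebra := e z with hζdef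
  -- `ζ` is central, `ζ l` central in `R l`, `ζ³ = q ζ`
  have hζc : ∀ w : ∀ l, (A l).endAlgebra, ζ * w = w * ζ := by
    intro w
    rw [Subalgebra.mem_center_iff] at hzc
    rw [hζdef, ← e.apply_symm_apply w, ← map_mul, ← map_mul, hzc]
  have hζlc : ∀ l, ζ l ∈ Subalgebra.center ℚ (A l).endAlgebra := fun l => Subalgebra.mem_center_iff.2 fun b => by
    have h := congrFun (hζc (Pi.single l b)) l
    simp only [Pi.mul_apply, Pi.single_eq_same] at h
    exact h.symm
  have hζ3 : ∀ l, ζ l * ζ l * ζ l = q • ζ l := fun l => by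
    have h := congrArg e hz3; rw [map_mul, map_mul, map_smul] at h; exact congrFun h l
  -- the centres are fields: `ζ l = 0` or `ζ l` is a unit with `ζ l ^ 2 = q`
  have hfield : ∀ l, IsField (Subalgebra.center ℚ (A l).endAlgebra) := by
    intro l
    obtain ⟨f, -⟩ := nonempty_algEquiv_center_endAlgebra_biproduct (B := B l) (Nat.succ_pos (nB l))
    exact MulEquiv.isField (isField_center_endAlgebra_of_isSimple (hS l) (hd l)) f.symm.toMulEquiv
  have hdich : ∀ l, ζ l = 0 ∨ (IsUnit (ζ l) ∧ ζ l * ζ l = algebraMap ℚ _ q) := by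
    intro l
    by_cases h : ζ l = 0
    · exact Or.inl h
    · right
      letI := (hfield l).toField
      have hne : (⟨ζ l, hζlc l⟩ : Subalgebra.center ℚ (A l).endAlgebra) ≠ 0 := fun h' => h (congrArg Subtype.val h')
      obtain ⟨b, hb⟩ := (hfield l).mul_inv_cancel hne
      have hb' : ζ l * (b : (A l).endAlgebra) = 1 := congrArg Subtype.val hb
      have hb'' : (b : (A l).endAlgebra) * ζ l = 1 := by
        rw [Subalgebra.mem_center_iff.1 (hζlc l) b]; exact hb'
      have hu : IsUnit (ζ l) := isUnit_iff_exists.2 ⟨b, hb', hb''⟩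
      refine ⟨hu, ?_⟩
      have h3 := hζ3 l
      -- cancel one `ζ l`
      have h' : ζ l * (ζ l * ζ l) = ζ l * algebraMap ℚ _ q := by
        rw [← mul_assoc, h3, Algebra.algebraMap_eq_smul_one, mul_smul_comm, mul_one]
      exact hu.mul_left_cancel h'
  -- both kinds of indices occur
  have hS'ne : ∃ i, ζ i = 0 := by
    by_contra h
    push Not at h
    apply hzu
    have hall : ∀ l, IsUnit (ζ l) := fun l => ((hdich l).resolve_left (h l)).1
    have hζu : IsUnit ζ := Pi.isUnit_iff.2 hall
    have := hζu.map e.symm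
    rwa [hζdef, e.symm_apply_apply] at this
  have hS''ne : ∃ j, ζ j ≠ 0 := by
    by_contra h
    push Not at h
    apply hz0
    apply e.injective
    rw [map_zero]
    exact funext h
  obtain ⟨i, hi⟩ := hS'ne
  -- exactly one index with `ζ = 0`: the centre of the corner `{w | z w = 0}` is `ℚ`
  have huniq : ∀ l, ζ l = 0 → l = i := by
    intro l hl
    by_contra hli
    -- the central idempotents `ε_l`, `ε_i` of the corner
    have hmem : ∀ k, ζ k = 0 → z * e.symm (Pi.single k 1) = 0 := by
      intro k hk
      apply e.injective
      rw [map_mul, map_zero, e.apply_symm_apply]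
      funext k'
      rw [Pi.mul_apply, Pi.zero_apply]
      by_cases hk' : k' = k
      · subst hk'; rw [Pi.single_eq_same, ← hζdef, hk, zero_mul]
      · rw [Pi.single_eq_of_ne hk', mul_zero]
    have hcomm : ∀ k, ζ k = 0 → ∀ w' : X.endAlgebra, z * w' = 0 →
        e.symm (Pi.single k 1) * w' = w' * e.symm (Pi.single k 1) := by
      intro k hk w' _
      apply e.injective
      rw [map_mul, map_mul, e.apply_symm_apply]
      funext k'
      rw [Pi.mul_apply, Pi.mul_apply]
      by_cases hk' : k' = k
      · subst hk'; rw [Pi.single_eq_same, one_mul, mul_one]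
      · rw [Pi.single_eq_of_ne hk', zero_mul, mul_zero]
    obtain ⟨cl, hcl⟩ := hcen _ (hmem l hl) (hcomm l hl)
    obtain ⟨ci, hci⟩ := hcen _ (hmem i hi) (hcomm i hi)
    -- evaluate `e` of both at `l`: `1 = cl • u`, `0 = ci • u` with `u = (e (1 - q⁻¹ z²)) l`, and at `i`
    have hl1 := congrFun (congrArg e hcl) l
    have hi1 := congrFun (congrArg e hci) l
    have hl2 := congrFun (congrArg e hcl) i
    have hi2 := congrFun (congrArg e hci) i
    rw [e.apply_symm_apply, map_smul, Pi.smul_apply] at hl1 hi1 hl2 hi2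
    rw [Pi.single_eq_same] at hl1 hi2
    rw [Pi.single_eq_of_ne (Ne.symm hli)] at hl2
    rw [Pi.single_eq_of_ne hli] at hi1
    haveI : Nontrivial (A l).endAlgebra := nontrivial_endAlgebra_of_dim_pos (B := A l) (by
      change 0 < (⨁ fun _ : Fin (nB l + 1) => B l).dim
      rw [AndreRiemann.dim_biproduct_const]; exact Nat.mul_pos (Nat.succ_pos _) (hd l))
    haveI : Nontrivial (A i).endAlgebra := nontrivial_endAlgebra_of_dim_pos (B := A i) (by
      change 0 < (⨁ fun _ : Fin (nB i + 1) => B i).dim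
      rw [AndreRiemann.dim_biproduct_const]; exact Nat.mul_pos (Nat.succ_pos _) (hd i))
    -- from `hl1`: `cl ≠ 0` and the `l`-component `u_l ≠ 0`; from `hi1`: `ci • u_l = 0`, so `ci = 0`; but `hi2`: `1 = ci • u_i`
    have hcl0 : cl ≠ 0 := by rintro rfl; rw [zero_smul] at hl1; exact one_ne_zero hl1
    have hul : e (1 - q⁻¹ • (z * z)) l ≠ 0 := by intro h; rw [h, smul_zero] at hl1; exact one_ne_zero hl1
    have hci0 : ci = 0 := by
      by_contra h
      exact hul ((smul_eq_zero.1 hi1.symm).resolve_left h)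
    rw [hci0, zero_smul] at hi2
    exact one_ne_zero hi2
  obtain ⟨j, hj⟩ := hS''ne
  have hij : i ≠ j := fun h => hj (h ▸ hi)
  -- dimensions of the corners: `{w | z w = 0} ≅ R i`, `{w | q w = z² w} ≅ ∏_{l ≠ i} R l`
  have hunit : ∀ l, l ≠ i → IsUnit (ζ l) ∧ ζ l * ζ l = algebraMap ℚ _ q := fun l hl =>
    (hdich l).resolve_left fun h => hl (huniq l h)
  let K' : Submodule ℚ X.endAlgebra :=
    { carrier := {w | z * w = 0}
      add_mem' := fun {a b} ha hb => by change z * (a + b) = 0; rw [mul_add, ha, hb, add_zero]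
      zero_mem' := by change z * 0 = 0; rw [mul_zero]
      smul_mem' := fun c a ha => by change z * (c • a) = 0; rw [mul_smul_comm, ha, smul_zero] }
  let K'' : Submodule ℚ X.endAlgebra :=
    { carrier := {w | q • w = z * z * w}
      add_mem' := fun {a b} ha hb => by
        change q • (a + b) = z * z * (a + b); rw [smul_add, mul_add, ha, hb]
      zero_mem' := by change q • (0 : X.endAlgebra) = z * z * 0; rw [smul_zero, mul_zero]
      smul_mem' := fun c a ha => by
        change q • (c • a) = z * z * (c • a); rw [smul_comm, ha, mul_smul_comm] }
  have hx2 := hxK K' (fun w => Iff.rfl)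
  have hy2 := hyK K'' (fun w => Iff.rfl)
  -- `K'` corresponds to `range (single i)`, `K''` to `ker (proj i)`
  set f : X.endAlgebra →ₗ[ℚ] (∀ l, (A l).endAlgebra) := e.toLinearEquiv.toLinearMap with hfdef
  have hf : ∀ w, f w = e w := fun w => rfl
  have hfinj : Function.Injective f := e.injective
  have hK'map : K'.map f = LinearMap.range (LinearMap.single ℚ (fun l => (A l).endAlgebra) i) := by
    ext w
    simp only [Submodule.mem_map, LinearMap.mem_range]
    constructor
    · rintro ⟨w₀, hw₀, rfl⟩
      refine ⟨e w₀ i, funext fun l => ?_⟩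
      by_cases hl : l = i
      · subst hl; rw [LinearMap.single_apply, Pi.single_eq_same]; rfl
      · rw [LinearMap.single_apply, Pi.single_eq_of_ne hl]
        have h : ζ l * e w₀ l = 0 := by
          have h' := congrFun (congrArg e (show z * w₀ = 0 from hw₀)) l; rw [map_mul, map_zero] at h'; exact h'
        exact ((hunit l hl).1.mul_right_eq_zero.1 h).symm
    · rintro ⟨b, rfl⟩
      refine ⟨e.symm (Pi.single i b), ?_, ?_⟩
      · change z * e.symm (Pi.single i b) = 0
        apply e.injective
        rw [map_mul, e.apply_symm_apply, map_zero]
        funext l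
        rw [Pi.mul_apply, Pi.zero_apply]
        by_cases hl : l = i
        · subst hl; rw [← hζdef, hi, zero_mul]
        · rw [Pi.single_eq_of_ne hl, mul_zero]
      · change e (e.symm (Pi.single i b)) = _
        rw [e.apply_symm_apply]; rfl
  -- `K' ⊕ K'' = End⁰(X)`
  have hq0 : q ≠ 0 := hq.ne
  have hinf : K' ⊓ K'' = ⊥ := by
    rw [Submodule.eq_bot_iff]
    intro w hw
    obtain ⟨h1, h2⟩ := Submodule.mem_inf.1 hw
    change z * w = 0 at h1
    change q • w = z * z * w at h2
    rw [mul_assoc, h1, mul_zero] at h2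
    calc w = q⁻¹ • (q • w) := by rw [smul_smul, inv_mul_cancel₀ hq0, one_smul]
      _ = 0 := by rw [h2, smul_zero]
  have hsup : K' ⊔ K'' = ⊤ := by
    rw [eq_top_iff]
    intro w _
    have hz4 : z * z * (z * z * w) = q • (z * z * w) := by
      rw [← mul_assoc, show z * z * (z * z) = z * z * z * z by simp only [mul_assoc], hz3, smul_mul_assoc, smul_mul_assoc,
        mul_assoc z z w]
    have hw : w = (w - q⁻¹ • (z * z * w)) + q⁻¹ • (z * z * w) := by rw [sub_add_cancel]
    rw [hw]
    refine Submodule.add_mem_sup ?_ ?_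
    · change z * (w - q⁻¹ • (z * z * w)) = 0
      rw [mul_sub, mul_smul_comm, ← mul_assoc, show z * (z * z) = z * z * z by rw [mul_assoc], hz3, smul_mul_assoc,
        smul_smul, inv_mul_cancel₀ hq0, one_smul, sub_self]
    · change q • (q⁻¹ • (z * z * w)) = z * z * (q⁻¹ • (z * z * w))
      rw [smul_smul, mul_inv_cancel₀ hq0, one_smul, mul_smul_comm, hz4, smul_smul, inv_mul_cancel₀ hq0, one_smul]
  have hdimK'' : Module.finrank ℚ K' + Module.finrank ℚ K'' = Module.finrank ℚ X.endAlgebra :=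
    finrank_add_finrank_of_isCompl K' K'' hinf hsup
  have hdimK' : Module.finrank ℚ K' = Module.finrank ℚ (A i).endAlgebra := by
    have hinj : Function.Injective (LinearMap.single ℚ (fun l => (A l).endAlgebra) i) := fun a b h => by
      have h' := congrFun h i
      simpa [LinearMap.coe_single] using h'
    rw [LinearEquiv.finrank_eq (Submodule.equivMapOfInjective f hfinj K'), hK'map, LinearMap.finrank_range_of_inj hinj]
  have hdimE : Module.finrank ℚ X.endAlgebra = ∑ l, (nB l + 1) ^ 2 * Module.finrank ℚ (B l).endAlgebra := by
    rw [e₁.toLinearEquiv.finrank_eq]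
    exact CMProductEnd.finrank_endAlgebra_biproduct_powers horth
  -- numerics: `dim R l = (nB l + 1)² d l`, `dim X = Σ (nB l + 1) g l`
  have hR : ∀ l, Module.finrank ℚ (A l).endAlgebra = (nB l + 1) ^ 2 * Module.finrank ℚ (B l).endAlgebra :=
    fun l => EndAlgebraPower.finrank_endAlgebra_biproduct (B l) (nB l + 1)
  have hdimX : X.dim = ∑ l, (nB l + 1) * (B l).dim := by
    obtain ⟨f, hf⟩ := hXB
    rw [dim_eq_of_isIsogeny hf, AndreRiemann.dim_biproduct_fin]
    exact Finset.sum_congr rfl fun l _ => AndreRiemann.dim_biproduct_const (B l) (nB l + 1)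
  have hle : ∀ l, Module.finrank ℚ (B l).endAlgebra ≤ 2 * (B l).dim := fun l =>
    finrank_endAlgebra_le_two_mul_dim_of_isSimple (hS l) (hd l)
  -- the numbers
  set m := nB i + 1 with hmdef
  set g := (B i).dim with hgdef
  set d := Module.finrank ℚ (B i).endAlgebra with hddef
  set a : Fin r → ℕ := fun l => (nB l + 1) * (B l).dim with hadef
  set T : Finset (Fin r) := Finset.univ.erase i with hTdef
  have hiuniv : i ∈ (Finset.univ : Finset (Fin r)) := Finset.mem_univ i
  have hc' : Module.finrank ℚ K' = m ^ 2 * d := by rw [hdimK', hR]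
  have hD : Module.finrank ℚ X.endAlgebra = m ^ 2 * d + ∑ l ∈ T, (nB l + 1) ^ 2 * Module.finrank ℚ (B l).endAlgebra := by
    rw [hdimE, ← Finset.add_sum_erase _ _ hiuniv]
  have hc'' : Module.finrank ℚ K'' = ∑ l ∈ T, (nB l + 1) ^ 2 * Module.finrank ℚ (B l).endAlgebra := by omega
  have hxy' : x + y = 2 * a i + 2 * ∑ l ∈ T, a l := by
    rw [hxy, hdimX, ← Finset.add_sum_erase _ _ hiuniv, mul_add]
  -- `x ≤ 2 m g`
  obtain ⟨hxle, hxeq⟩ := le_of_sq_eq_four_mul_sq_mul (x := x) (Nat.succ_pos (nB i)) (hd i) (hle i) (by rw [hx2, hc'])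
  have hai : a i = m * g := rfl
  -- `y ≤ 2 Σ_{l ≠ i} a l`
  have hterm : ∀ l, (nB l + 1) ^ 2 * Module.finrank ℚ (B l).endAlgebra ≤ 2 * a l ^ 2 := by
    intro l
    have h1 := hle l
    have h2 : (B l).dim ≤ (B l).dim ^ 2 := by nlinarith [hd l]
    calc (nB l + 1) ^ 2 * Module.finrank ℚ (B l).endAlgebra ≤ (nB l + 1) ^ 2 * (2 * (B l).dim) :=
          Nat.mul_le_mul_left _ h1
      _ ≤ (nB l + 1) ^ 2 * (2 * (B l).dim ^ 2) := Nat.mul_le_mul_left _ (Nat.mul_le_mul_left _ h2)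
      _ = 2 * a l ^ 2 := by rw [hadef]; ring
  have hsumle : ∑ l ∈ T, (nB l + 1) ^ 2 * Module.finrank ℚ (B l).endAlgebra ≤ 2 * ∑ l ∈ T, a l ^ 2 := by
    rw [Finset.mul_sum]
    exact Finset.sum_le_sum fun l _ => hterm l
  have hsq := sum_sq_le_sq_sum T a
  have hy2' : y ^ 2 ≤ (2 * ∑ l ∈ T, a l) ^ 2 := by
    rw [hy2, hc'', mul_pow, show (2 : ℕ) ^ 2 = 2 * 2 by norm_num, mul_assoc]
    exact Nat.mul_le_mul_left 2 (hsumle.trans (Nat.mul_le_mul_left 2 hsq))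
  have hyle : y ≤ 2 * ∑ l ∈ T, a l := (Nat.pow_le_pow_iff_left two_ne_zero).1 hy2'
  -- hence equalities
  have hxle' : x ≤ 2 * (m * g) := by rw [← mul_assoc]; exact hxle
  rw [hai] at hxy'
  have hxeq'' : x = 2 * (m * g) := by omega
  have hxeq' : x = 2 * m * g := by rw [mul_assoc]; exact hxeq''
  have hyeq : y = 2 * ∑ l ∈ T, a l := by omega
  have hdg : d = g ^ 2 := hxeq hxeq'
  -- exactly one index in `T`
  have hjT : j ∈ T := Finset.mem_erase.2 ⟨hij.symm, Finset.mem_univ j⟩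
  have hposT : ∀ l ∈ T, 0 < a l := fun l _ => Nat.mul_pos (Nat.succ_pos _) (hd l)
  have hsqeq : (∑ l ∈ T, a l) ^ 2 = ∑ l ∈ T, a l ^ 2 := by
    apply le_antisymm _ hsq
    have h : y ^ 2 = 4 * (∑ l ∈ T, a l) ^ 2 := by rw [hyeq]; ring
    rw [hy2, hc''] at h
    omega
  have hT : ∀ l, l ≠ i → l = j := fun l hl =>
    eq_of_sq_sum_eq_sum_sq T a hposT hsqeq hjT (Finset.mem_erase.2 ⟨hl, Finset.mem_univ l⟩)
  have hall : ∀ l, l = i ∨ l = j := fun l => (eq_or_ne l i).imp_right (hT l)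
  have hTj : T = {j} := by
    ext l
    simp only [hTdef, Finset.mem_erase, Finset.mem_univ, and_true, Finset.mem_singleton]
    exact ⟨fun h => hT l h, fun h => h ▸ hij.symm⟩
  -- the `j`-component: `d_j = 2 g_j²`, `g_j = 1`, `d_j = 2`
  rw [hTj, Finset.sum_singleton] at hc'' hyeq
  have hyy : y ^ 2 = 2 * ((nB j + 1) ^ 2 * Module.finrank ℚ (B j).endAlgebra) := by rw [hy2, hc'']
  rw [hyeq, hadef] at hyy
  have hdj : Module.finrank ℚ (B j).endAlgebra = 2 * (B j).dim ^ 2 := by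
    have h : 2 * ((nB j + 1) ^ 2 * Module.finrank ℚ (B j).endAlgebra) = 2 * ((nB j + 1) ^ 2 * (2 * (B j).dim ^ 2)) := by
      rw [← hyy]; ring
    have h' := Nat.eq_of_mul_eq_mul_left (by norm_num : 0 < 2) h
    exact Nat.eq_of_mul_eq_mul_left (pow_pos (Nat.succ_pos (nB j)) 2) h'
  have hgj : (B j).dim = 1 := by
    have h := hle j
    rw [hdj, pow_two, mul_comm 2 ((B j).dim * (B j).dim), mul_assoc, mul_comm 2 (B j).dim] at h
    have h' := Nat.le_of_mul_le_mul_left h (hd j)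
    have hpos := hd j
    omega
  have hdj2 : Module.finrank ℚ (B j).endAlgebra = 2 := by rw [hdj, hgj]; ring
  -- `B j` is of CM type (an elliptic curve with `End⁰ ≠ ℚ`), `B i` is not (else `X` would be)
  have hcmj : IsOfCMType (B j) := by
    by_contra h
    have h1 := finrank_endAlgebra_eq_one_of_dim_one (AbelianVariety.isSmoothProjective_holds (A := B j)) hgj h
    omega
  have hcmi : ¬ IsOfCMType (B i) := by
    intro hi'
    apply hcm
    rw [isOfCMType_iff_of_isIsogenous hXB, CMProductEnd.isOfCMType_biproduct_powers_iff B nB]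
    intro l
    rcases hall l with rfl | rfl
    exacts [hi', hcmj]
  have hgi : g ≤ 2 := by
    have h := hle i
    rw [← hddef, hdg, ← hgdef, pow_two, mul_comm 2 g] at h
    have hpos := hd i
    rw [← hgdef] at hpos
    exact Nat.le_of_mul_le_mul_left h hpos
  exact ⟨r, B, nB, i, j, hS, hd, hni, hXB, hij, hall, hcmi, by rw [← hddef, hdg], hgi, hgj, hdj2, hcmj⟩

/-- **Complex abelian varieties NOT of CM type with `dim MT(H¹(X)) ≤ 5`** (`0 < dim X`): since `dim Hg + 1 ≤ dim MT`
(`finrank_hodgeLie_add_one_le_mtRank`), `dim_ℚ Lie Hg(H¹X) ≤ 4`, so EITHER `dim Lie Hg ≤ 3` and `X ∼ B^{m+1}` with `B`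
simple, not of CM type, `Z(End⁰ B) = ℚ`, `dim End⁰(B) = (dim B)²` (`exists_isIsogenous_power_of_finrank_hodgeLie_le_three`,
the rung of `CorCM/MumfordTateRankFour`), OR `dim Lie Hg = 4` and `X ∼ Bᵢ^{nᵢ+1} × Bⱼ^{nⱼ+1}` as in
`exists_isIsogenous_two_powers_of_finrank_hodgeLie_eq_four`. [cite: MoonenZarhin1999LowDim, §2]
[cite: MumfordAV1970, §19 Thm. 1 Cor. 1–2 and p. 174] -/
theorem exists_isIsogenous_powers_of_mtRank_le_five (hX : IsSmoothProjective n X.X) (h0 : 0 < X.dim)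
    (hcm : ¬ IsOfCMType X)
    (h5 : haveI := BettiUniverse.finite hX 1
      (BettiUniverse.hodge exists_isReal_hodgeModel_holds hX 1).mtRank ≤ 5) :
    (∃ (B : AbelianVariety ℂ) (m : ℕ), B.IsSimple ∧ 0 < B.dim ∧ ¬ IsOfCMType B ∧
      IsIsogenous X (⨁ fun _ : Fin (m + 1) => B) ∧ X.dim = (m + 1) * B.dim ∧
      Module.finrank ℚ B.endAlgebra = B.dim ^ 2 ∧ Module.finrank ℚ (Subalgebra.center ℚ B.endAlgebra) = 1) ∨
    (∃ (r : ℕ) (B : Fin r → AbelianVariety ℂ) (nB : Fin r → ℕ) (i j : Fin r),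
      (∀ l, (B l).IsSimple) ∧ (∀ l, 0 < (B l).dim) ∧ (∀ l l', l ≠ l' → ¬ IsIsogenous (B l) (B l')) ∧
      IsIsogenous X (⨁ fun l => ⨁ fun _ : Fin (nB l + 1) => B l) ∧
      i ≠ j ∧ (∀ l, l = i ∨ l = j) ∧
      ¬ IsOfCMType (B i) ∧ Module.finrank ℚ (B i).endAlgebra = (B i).dim ^ 2 ∧ (B i).dim ≤ 2 ∧
      (B j).dim = 1 ∧ Module.finrank ℚ (B j).endAlgebra = 2 ∧ IsOfCMType (B j)) := by
  have hn : X.dim = n := schemeDim_eq_holds hX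
  subst hn
  haveI := BettiUniverse.finite hX 1
  haveI := nontrivial_bettiCohomology_one h0
  obtain ⟨ψ⟩ := BettiUniverse.hodge_isPolarizable exists_isReal_hodgeModel_holds hX 1
  have hle := finrank_hodgeLie_add_one_le_mtRank _ ψ (by simp)
  by_cases h4 : Module.finrank ℚ (BettiUniverse.hodge exists_isReal_hodgeModel_holds hX 1).hodgeLie = 4
  · exact Or.inr (exists_isIsogenous_two_powers_of_finrank_hodgeLie_eq_four hX hcm h4)
  · exact Or.inl (exists_isIsogenous_power_of_finrank_hodgeLie_le_three hX h0 hcm (by omega))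

end Summit.HodgeConjecture.CorCM

end
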